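import Mathlib
import HarnessLib
import Literature.Analysis.Convex.IshikawaAsymptoticRegularity

/-!
# Quasi-nonexpansive operators and the Krasnoselskij iteration

[cite: Berinde2007, Ch. 3 §3.5 "Quasi nonexpansive operators", pp. 79–82 (Lemmas 3.5, 3.6, 3.7,
Theorem 3.9), Ch. 2 §2.3 (definition of quasi-nonexpansiveness), Exercises 2.13–2.17 and
3.20–3.21; bibliographical comments §3.6]

V. Berinde, *Iterative Approximation of Fixed Points*, 2nd ed., Lecture Notes in Mathematics
1912, Springer 2007.  By the book's own bibliographical comments (§3.6) the whole of §3.5 is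
taken from W. V. Petryshyn and T. E. Williamson, *Strong and weak convergence of the sequence of
successive approximations for quasi-nonexpansive mappings*, J. Math. Anal. Appl. **43** (1973)
459–497, doi:10.1016/0022-247X(73)90087-5 (Lemma 3.5 = Lemma 2.1, Lemma 3.6 = Lemma 2.2,
Lemma 3.7 = Lemma 3.1, Theorem 3.9 = Theorem 3.3 there); the convergence criterion behind
Exercises 2.13–2.14 is Theorem 1.1 of the same paper (announced in Bull. Amer. Math. Soc. 78
(1972), doi:10.1090/S0002-9904-1972-13095-7).

A self-map `T` of a metric space is *quasi-nonexpansive* on `D` if it does not increase the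
distance to any of its fixed points in `D`: `dist (T x) p ≤ dist x p` for `x ∈ D`, `p ∈ D`,
`T p = p`.  This file records:

* `fixIn T D` (the fixed points of `T` in `D`), `IsQuasiNonexpansiveOn T D`; nonexpansive maps are
  quasi-nonexpansive; the fixed point set of a quasi-nonexpansive map is closed when `D` is
  closed (no continuity needed) — `IsQuasiNonexpansiveOn.isClosed_fixIn`;
* the Petryshyn–Williamson convergence criterion (Exercise 2.13; the engine behind 2.14 and
  Theorem 3.9): for a quasi-nonexpansive `T` on a closed subset `D` of a complete space, an orbit
  `x (n+1) = T (x n)` in `D` converges to a fixed point iff `infDist (x n) (fixIn T D) → 0`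
  (`IsQuasiNonexpansiveOn.exists_mem_fixIn_tendsto`, `tendsto_infDist_of_tendsto`), the
  asymptotic-regularity version of Exercise 2.14
  (`IsQuasiNonexpansiveOn.exists_mem_fixIn_tendsto_of_asymptoticallyRegular`), and the
  subsequence criterion used in the last step of Theorem 3.9: `T` continuous, strictly
  quasi-nonexpansive at non-fixed points, an orbit with a convergent subsequence ⟹ the orbit
  converges to a fixed point (`IsQuasiNonexpansiveOn.tendsto_of_subseq_tendsto`; both criteria
  are also printed in V. I. Istrăţescu, *Fixed Point Theory*, Reidel 1981, Theorems 6.6.7 and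
  6.6.9);
* in a real normed space, for the averaged map `T_t = (1 - t) I + t T` (we reuse
  `relaxedMap` / `relaxedIter` of `Literature.Analysis.Convex.IshikawaAsymptoticRegularity`):
  `Fix T_t = Fix T` and `T_t` is quasi-nonexpansive (`fixIn_relaxedMap`,
  `IsQuasiNonexpansiveOn.relaxedMap`);
* **Lemma 3.5** (uniformly convex `E`): if `T` is quasi-nonexpansive with respect to one fixed
  point `p` and `x (n+1) = T_t (x n)`, `0 < t < 1`, stays in `D`, then `‖x n - T (x n)‖ → 0`, hence
  `x n - x (n+1) → 0` (`T_t` is asymptotically regular) —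
  `tendsto_norm_sub_apply_of_uniformConvexSpace`, `tendsto_sub_succ_of_uniformConvexSpace`;
  the quantitative uniform-convexity step is `exists_norm_combo_le`;
* **Lemma 3.6** (strictly convex `E`): `Fix T` is convex for `T` quasi-nonexpansive on a convex
  `D` (`IsQuasiNonexpansiveOn.convex_fixIn`); and the strict decrease
  `‖T_t x - p‖ < ‖x - p‖` off the fixed point set (`norm_relaxedMap_sub_lt`);
* **Lemma 3.7**: if `K` is convex and `infDist (T x) K ≤ k * infDist x K` on `D` (the
  Frum–Ketkov condition (25)), then `infDist (T_t x) K ≤ ((1 - t) + t * k) * infDist x K`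
  (`infDist_relaxedMap_le`);
* **Theorem 3.9**: `D` closed convex in a strictly convex real normed space, `T : D → D`
  continuous and quasi-nonexpansive with a fixed point, `K` compact convex nonempty, `k < 1`,
  condition (25), `0 < t < 1` ⟹ the Krasnoselskij iteration `relaxedIter T t x₀` converges to a
  fixed point of `T` in `D`, for every `x₀ ∈ D` (`exists_mem_fixIn_tendsto_relaxedIter`).

Declared deviations from the printed text.
(a) The book's Definition (Ch. 2) builds `Fix T ≠ ∅` into "quasi-nonexpansive"; here
    nonemptiness of `fixIn T D` is a separate hypothesis where it is used.
(b) Theorem 3.9 is printed for a *conditionally* quasi-nonexpansive `T` *without continuity*,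
    the existence of a fixed point being supplied by the Frum–Ketkov theorem (Exercise 3.20,
    proved via Schauder's theorem, which Mathlib does not have).  As printed the statement is
    false: the last step of the proof ("`T_λ` continuous implies `T_λ x* = x*`") uses continuity,
    and `Counterexample.not_exists_tendsto_relaxedIter` below is an explicit quasi-nonexpansive,
    discontinuous self-map of `ℝ` satisfying every other hypothesis whose Krasnoselskij iterates
    converge to a non-fixed point.  We therefore assume `ContinuousOn T D` (as Petryshyn and
    Williamson do: their maps are continuous throughout, cf. Exercises 2.13–2.17) and take the
    existence of a fixed point in `D` as a hypothesis instead of deriving it from Frum–Ketkov.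
    `K` is assumed nonempty (tacit in the book, where `d(x, K)` is used).
(c) Lemma 3.6 is printed for continuous `T`; continuity is not needed and not assumed, and the
    closedness half holds in any metric space.
(d) Lemma 3.5 is proved by the standard uniform-convexity estimate applied to the pair
    `(x n - p, T (x n) - p)` for a general `t ∈ (0,1)` (reduction to the midpoint modulus via
    `min t (1 - t)`); the book's displayed inequalities compare `x n - p` with `T_λ x n - p`,
    which is a misprint of the same argument.
(e) The averaged map is written `(1 - t) • x + t • T x` (`relaxedMap`), the book writes
    `λ x + (1 - λ) T x`; the statements correspond under `t = 1 - λ`, and Lemma 3.7's constant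
    `k_λ = λ + (1 - λ) k` becomes `(1 - t) + t * k`.
Exercise 3.21 (a conditionally quasi-nonexpansive map without fixed points), Theorem 3.8
(§3.4) and the Frum–Ketkov theorem itself are not formalised.
-/

open Filter Topology Set Metric Function
open Literature.Analysis.Convex.IshikawaAsymptoticRegularity

namespace Literature.Analysis.Convex.QuasiNonexpansiveOperators

/-! ### Real sequences: an antitone sequence with a convergent subsequence converges -/

/-- [cite: Berinde2007, Ch. 3 §3.5, proof of Theorem 3.9, p. 82 ("it results that `(x_n)`
converges to `x*`")] -/
theorem tendsto_of_antitone_of_subseq {r : ℕ → ℝ} {φ : ℕ → ℕ} {L : ℝ} (hanti : Antitone r)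
    (hφ : StrictMono φ) (hL : Tendsto (r ∘ φ) atTop (𝓝 L)) : Tendsto r atTop (𝓝 L) := by
  have hmono : Antitone (r ∘ φ) := fun i j hij => hanti (hφ.monotone hij)
  have hLle : ∀ n, L ≤ r n := fun n => (hmono.le_of_tendsto hL n).trans (hanti (hφ.id_le n))
  have hbdd : BddBelow (range r) := ⟨L, by rintro _ ⟨n, rfl⟩; exact hLle n⟩
  have hconv := tendsto_atTop_ciInf hanti hbdd
  have hinf : (⨅ n, r n) = L := tendsto_nhds_unique (hconv.comp hφ.tendsto_atTop) hL
  rwa [hinf] at hconv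

section Metric

variable {X : Type*}

/-- The fixed points of `T` lying in `D`, i.e. `F_T ∩ D`.
[cite: Berinde2007, Ch. 3 §3.5, p. 79] -/
def fixIn (T : X → X) (D : Set X) : Set X := {p | p ∈ D ∧ T p = p}

/-- [cite: Berinde2007, Ch. 3 §3.5, p. 79] -/
theorem mem_fixIn {T : X → X} {D : Set X} {p : X} : p ∈ fixIn T D ↔ p ∈ D ∧ T p = p :=
  Iff.rfl

/-- [cite: Berinde2007, Ch. 3 §3.5, p. 79] -/
theorem fixIn_subset (T : X → X) (D : Set X) : fixIn T D ⊆ D := fun _ hp => hp.1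

variable [MetricSpace X]

/-- `T` is quasi-nonexpansive on `D`: it does not increase the distance to any of its fixed
points in `D`.  (The book additionally requires `Fix T ≠ ∅`; see deviation (a).)
[cite: Berinde2007, Ch. 2 §2.3 pp. 36–37 and Ch. 3 §3.5 p. 79] -/
def IsQuasiNonexpansiveOn (T : X → X) (D : Set X) : Prop :=
  ∀ ⦃p⦄, p ∈ fixIn T D → ∀ ⦃x⦄, x ∈ D → dist (T x) p ≤ dist x p

variable {T : X → X} {D : Set X}

/-- A nonexpansive map is quasi-nonexpansive ("it is obvious that this concept generalizes
that of a nonexpansive mapping").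
[cite: Berinde2007, Ch. 3 §3.5, p. 79] -/
theorem IsQuasiNonexpansiveOn.of_nonexpansive
    (h : ∀ x ∈ D, ∀ y ∈ D, dist (T x) (T y) ≤ dist x y) : IsQuasiNonexpansiveOn T D := by
  intro p hp x hx
  have h' := h x hx p hp.1
  rwa [hp.2] at h'

/-- Restriction to a smaller set.
[cite: Berinde2007, Ch. 3 §3.5, p. 79] -/
theorem IsQuasiNonexpansiveOn.mono (h : IsQuasiNonexpansiveOn T D) {D' : Set X}
    (hD' : D' ⊆ D) : IsQuasiNonexpansiveOn T D' :=
  fun _ hp _ hx => h ⟨hD' hp.1, hp.2⟩ (hD' hx)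

/-- The fixed point set of a quasi-nonexpansive map on a closed set is closed; continuity of
`T` is not needed (first half of Lemma 3.6, valid in any metric space).
[cite: Berinde2007, Ch. 3 §3.5, Lemma 3.6, p. 80] -/
theorem IsQuasiNonexpansiveOn.isClosed_fixIn (h : IsQuasiNonexpansiveOn T D)
    (hD : IsClosed D) : IsClosed (fixIn T D) := by
  refine isClosed_of_closure_subset fun q hq => ?_
  obtain ⟨u, hu, huq⟩ := mem_closure_iff_seq_limit.1 hq
  have hqD : q ∈ D := hD.mem_of_tendsto huq (Eventually.of_forall fun n => (hu n).1)
  refine ⟨hqD, ?_⟩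
  have huT : Tendsto u atTop (𝓝 (T q)) := by
    rw [tendsto_iff_dist_tendsto_zero]
    refine squeeze_zero (fun _ => dist_nonneg) (fun n => ?_)
      (tendsto_iff_dist_tendsto_zero.1 huq)
    rw [dist_comm (u n), dist_comm (u n)]
    exact h (hu n) hqD
  exact tendsto_nhds_unique huT huq

/-- Along an orbit in `D` the distance to a fixed point does not increase.
[cite: Berinde2007, Ch. 3 §3.5, proof of Theorem 3.9, pp. 81–82] -/
theorem IsQuasiNonexpansiveOn.dist_succ_le (h : IsQuasiNonexpansiveOn T D) {x : ℕ → X}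
    (hx : ∀ n, x (n + 1) = T (x n)) (hxD : ∀ n, x n ∈ D) {p : X} (hp : p ∈ fixIn T D)
    (n : ℕ) : dist (x (n + 1)) p ≤ dist (x n) p := by
  rw [hx n]
  exact h hp (hxD n)

/-- [cite: Berinde2007, Ch. 3 §3.5, proof of Theorem 3.9, pp. 81–82] -/
theorem IsQuasiNonexpansiveOn.antitone_dist (h : IsQuasiNonexpansiveOn T D) {x : ℕ → X}
    (hx : ∀ n, x (n + 1) = T (x n)) (hxD : ∀ n, x n ∈ D) {p : X} (hp : p ∈ fixIn T D) :
    Antitone fun n => dist (x n) p :=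
  antitone_nat_of_succ_le fun n => h.dist_succ_le hx hxD hp n

/-- Along an orbit the distance to the fixed point set does not increase.
[cite: Berinde2007, Ch. 2 Exercise 2.14 (e) (pp. 59–62); Ch. 3 §3.5] -/
theorem IsQuasiNonexpansiveOn.infDist_succ_le (h : IsQuasiNonexpansiveOn T D) {x : ℕ → X}
    (hx : ∀ n, x (n + 1) = T (x n)) (hxD : ∀ n, x n ∈ D) (n : ℕ) :
    infDist (x (n + 1)) (fixIn T D) ≤ infDist (x n) (fixIn T D) := by
  rcases (fixIn T D).eq_empty_or_nonempty with hF | hF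
  · simp [hF]
  · exact (le_infDist hF).2 fun p hp =>
      (infDist_le_dist_of_mem hp).trans (h.dist_succ_le hx hxD hp n)

/-- [cite: Berinde2007, Ch. 2 Exercise 2.14 (e) (pp. 59–62); Ch. 3 §3.5] -/
theorem IsQuasiNonexpansiveOn.antitone_infDist (h : IsQuasiNonexpansiveOn T D) {x : ℕ → X}
    (hx : ∀ n, x (n + 1) = T (x n)) (hxD : ∀ n, x n ∈ D) :
    Antitone fun n => infDist (x n) (fixIn T D) :=
  antitone_nat_of_succ_le fun n => h.infDist_succ_le hx hxD n

/-- Petryshyn–Williamson: if the distance of the orbit to the fixed point set tends to zero,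
the orbit is a Cauchy sequence.
[cite: Berinde2007, Ch. 2 Exercises 2.13–2.14 (pp. 59–62); Ch. 3 §3.6 (Petryshyn–Williamson 1973,
Theorem 1.1)] -/
theorem IsQuasiNonexpansiveOn.cauchySeq_of_tendsto_infDist (h : IsQuasiNonexpansiveOn T D)
    {x : ℕ → X} (hx : ∀ n, x (n + 1) = T (x n)) (hxD : ∀ n, x n ∈ D)
    (hne : (fixIn T D).Nonempty)
    (hF : Tendsto (fun n => infDist (x n) (fixIn T D)) atTop (𝓝 0)) : CauchySeq x := by
  refine Metric.cauchySeq_iff'.2 fun ε hε => ?_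
  have hev : ∀ᶠ n in atTop, infDist (x n) (fixIn T D) < ε / 2 :=
    (tendsto_order.1 hF).2 _ (half_pos hε)
  obtain ⟨N, hN⟩ := hev.exists
  obtain ⟨p, hp, hNp⟩ := (infDist_lt_iff hne).1 hN
  refine ⟨N, fun n hn => ?_⟩
  calc dist (x n) (x N) ≤ dist (x n) p + dist (x N) p := dist_triangle_right _ _ _
    _ ≤ dist (x N) p + dist (x N) p := add_le_add (h.antitone_dist hx hxD hp hn) le_rfl
    _ < ε := by linarith

/-- If an orbit converges to a point of `F`, its distance to `F` tends to zero (the trivial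
direction of the Petryshyn–Williamson criterion).
[cite: Berinde2007, Ch. 2 Exercise 2.13 (pp. 59–62)] -/
theorem tendsto_infDist_of_tendsto {F : Set X} {x : ℕ → X} {p : X} (hp : p ∈ F)
    (hxp : Tendsto x atTop (𝓝 p)) : Tendsto (fun n => infDist (x n) F) atTop (𝓝 0) :=
  squeeze_zero (fun _ => infDist_nonneg) (fun _ => infDist_le_dist_of_mem hp)
    (tendsto_iff_dist_tendsto_zero.1 hxp)

/-- Petryshyn–Williamson convergence criterion (sufficiency): `T` quasi-nonexpansive on a closed
subset `D` of a complete metric space with a fixed point in `D`; an orbit in `D` whose distance to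
`fixIn T D` tends to zero converges to a fixed point of `T` in `D`.
[cite: Berinde2007, Ch. 2 Exercises 2.13–2.14 (pp. 59–62); Ch. 3 §3.5 proof of Theorem 3.9;
§3.6 (Petryshyn–Williamson 1973, Theorem 1.1)] -/
theorem IsQuasiNonexpansiveOn.exists_mem_fixIn_tendsto [CompleteSpace X]
    (h : IsQuasiNonexpansiveOn T D) (hD : IsClosed D) {x : ℕ → X}
    (hx : ∀ n, x (n + 1) = T (x n)) (hxD : ∀ n, x n ∈ D) (hne : (fixIn T D).Nonempty)
    (hF : Tendsto (fun n => infDist (x n) (fixIn T D)) atTop (𝓝 0)) :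
    ∃ p ∈ fixIn T D, Tendsto x atTop (𝓝 p) := by
  obtain ⟨q, hq⟩ :=
    cauchySeq_tendsto_of_complete (h.cauchySeq_of_tendsto_infDist hx hxD hne hF)
  refine ⟨q, ?_, hq⟩
  have h0 : infDist q (fixIn T D) = 0 :=
    tendsto_nhds_unique (((continuous_infDist_pt (fixIn T D)).tendsto q).comp hq) hF
  exact ((h.isClosed_fixIn hD).mem_iff_infDist_zero hne).2 h0

/-- Petryshyn–Williamson convergence criterion, both directions.
[cite: Berinde2007, Ch. 2 Exercises 2.13–2.14 (pp. 59–62); §3.6 (Petryshyn–Williamson 1973,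
Theorem 1.1)] -/
theorem IsQuasiNonexpansiveOn.exists_mem_fixIn_tendsto_iff [CompleteSpace X]
    (h : IsQuasiNonexpansiveOn T D) (hD : IsClosed D) {x : ℕ → X}
    (hx : ∀ n, x (n + 1) = T (x n)) (hxD : ∀ n, x n ∈ D) (hne : (fixIn T D).Nonempty) :
    (∃ p ∈ fixIn T D, Tendsto x atTop (𝓝 p)) ↔
      Tendsto (fun n => infDist (x n) (fixIn T D)) atTop (𝓝 0) :=
  ⟨fun ⟨_, hp, hxp⟩ => tendsto_infDist_of_tendsto hp hxp,
    h.exists_mem_fixIn_tendsto hD hx hxD hne⟩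

/-- Exercise 2.14 (Petryshyn–Williamson): `T` quasi-nonexpansive on a closed `D` in a complete
space, with a fixed point; if the orbit is asymptotically regular (`dist (x n) (T (x n)) → 0`)
and `T` satisfies condition (e) — every sequence `y n ∈ D` with `dist (y n) (T (y n)) → 0` has
`liminf infDist (y n) (Fix T) = 0`, phrased as "frequently `< ε`" — then the orbit converges to a
fixed point.  (Continuity of `T`, assumed in the exercise, is not needed.)
[cite: Berinde2007, Ch. 2 Exercise 2.14 (pp. 59–62); §3.6 (Petryshyn–Williamson 1973)] -/
theorem IsQuasiNonexpansiveOn.exists_mem_fixIn_tendsto_of_asymptoticallyRegular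
    [CompleteSpace X] (h : IsQuasiNonexpansiveOn T D) (hD : IsClosed D)
    (hne : (fixIn T D).Nonempty) {x : ℕ → X} (hx : ∀ n, x (n + 1) = T (x n))
    (hxD : ∀ n, x n ∈ D) (har : Tendsto (fun n => dist (x n) (T (x n))) atTop (𝓝 0))
    (he : ∀ y : ℕ → X, (∀ n, y n ∈ D) → Tendsto (fun n => dist (y n) (T (y n))) atTop (𝓝 0) →
      ∀ ε > 0, ∃ᶠ n in atTop, infDist (y n) (fixIn T D) < ε) :
    ∃ p ∈ fixIn T D, Tendsto x atTop (𝓝 p) := by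
  refine h.exists_mem_fixIn_tendsto hD hx hxD hne (Metric.tendsto_atTop.2 fun ε hε => ?_)
  obtain ⟨N, hN⟩ := (he x hxD har ε hε).exists
  refine ⟨N, fun n hn => ?_⟩
  rw [dist_zero_right, Real.norm_of_nonneg infDist_nonneg]
  exact (h.antitone_infDist hx hxD hn).trans_lt hN

/-- Petryshyn–Williamson's subsequence criterion — the pattern of the last step of the proof of
Theorem 3.9 (also Istrăţescu, *Fixed Point Theory* (1981), Theorem 6.6.9): `T` continuous on
the closed set `D`, quasi-nonexpansive, and strictly so at non-fixed points (for `x ∈ D` with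
`T x ≠ x` there is a fixed point `p` with `dist (T x) p < dist x p`).  If an orbit in `D` has a
subsequence converging to `a`, then `a` is a fixed point of `T` and the whole orbit converges
to `a`.
[cite: Berinde2007, Ch. 3 §3.5, proof of Theorem 3.9, pp. 81–82; §3.6] -/
theorem IsQuasiNonexpansiveOn.tendsto_of_subseq_tendsto (h : IsQuasiNonexpansiveOn T D)
    (hD : IsClosed D) (hcont : ContinuousOn T D)
    (hstrict : ∀ x ∈ D, T x ≠ x → ∃ p ∈ fixIn T D, dist (T x) p < dist x p) {x : ℕ → X}
    (hx : ∀ n, x (n + 1) = T (x n)) (hxD : ∀ n, x n ∈ D) {φ : ℕ → ℕ} (hφ : StrictMono φ)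
    {a : X} (ha : Tendsto (x ∘ φ) atTop (𝓝 a)) : a ∈ fixIn T D ∧ Tendsto x atTop (𝓝 a) := by
  have haD : a ∈ D := hD.mem_of_tendsto ha (Eventually.of_forall fun j => hxD (φ j))
  have haW : Tendsto (x ∘ φ) atTop (𝓝[D] a) :=
    tendsto_nhdsWithin_iff.2 ⟨ha, Eventually.of_forall fun j => hxD (φ j)⟩
  have hTa : Tendsto (fun j => x (φ j + 1)) atTop (𝓝 (T a)) := by
    refine (((hcont a haD).tendsto).comp haW).congr fun j => ?_
    simp only [Function.comp_apply, hx]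
  have haT : T a = a := by
    by_contra hne
    obtain ⟨p, hp, hlt⟩ := hstrict a haD hne
    have hanti := h.antitone_dist hx hxD hp
    have hra : Tendsto (fun j => dist ((x ∘ φ) j) p) atTop (𝓝 (dist a p)) :=
      ha.dist tendsto_const_nhds
    have hr : Tendsto (fun n => dist (x n) p) atTop (𝓝 (dist a p)) :=
      tendsto_of_antitone_of_subseq hanti hφ hra
    have hr1 : Tendsto (fun j => dist (x (φ j + 1)) p) atTop (𝓝 (dist (T a) p)) :=
      hTa.dist tendsto_const_nhds
    have hr2 : Tendsto (fun j => dist (x (φ j + 1)) p) atTop (𝓝 (dist a p)) :=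
      hr.comp ((tendsto_add_atTop_nat 1).comp hφ.tendsto_atTop)
    exact hlt.ne (tendsto_nhds_unique hr1 hr2)
  refine ⟨⟨haD, haT⟩, ?_⟩
  have hanti' := h.antitone_dist hx hxD ⟨haD, haT⟩
  have h0 : Tendsto (fun j => dist (x (φ j)) a) atTop (𝓝 0) := by
    have h0' := tendsto_iff_dist_tendsto_zero.1 ha
    simpa [Function.comp_def] using h0'
  exact tendsto_iff_dist_tendsto_zero.2 (tendsto_of_antitone_of_subseq hanti' hφ h0)

end Metric

section Normed

variable {E : Type*} [NormedAddCommGroup E] [NormedSpace ℝ E]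
variable {T : E → E} {D : Set E} {t : ℝ}

/-- `T_t x - p = (1 - t) (x - p) + t (T x - p)`.
[cite: Berinde2007, Ch. 3 §3.5, proof of Lemma 3.5, pp. 79–80] -/
theorem relaxedMap_sub (T : E → E) (t : ℝ) (x p : E) :
    relaxedMap T t x - p = (1 - t) • (x - p) + t • (T x - p) := by
  simp only [relaxedMap_apply]
  module

/-- `Fix T_t = Fix T` for `t ≠ 0`.
[cite: Berinde2007, Ch. 3 §3.5, proof of Theorem 3.9, pp. 81–82 ("`F(T) ≡ F(T_λ) ≠ ∅`")] -/
theorem fixIn_relaxedMap (ht : t ≠ 0) : fixIn (relaxedMap T t) D = fixIn T D := by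
  ext p
  simp only [mem_fixIn, relaxedMap_eq_self_iff ht]

/-- `‖T_t x - p‖ ≤ ‖x - p‖` whenever `‖T x - p‖ ≤ ‖x - p‖`, `t ∈ [0,1]`.
[cite: Berinde2007, Ch. 3 §3.5, proof of Theorem 3.9, pp. 81–82 ("`T_λ` is quasi-nonexpansive")] -/
theorem norm_relaxedMap_sub_le (ht : t ∈ Icc (0 : ℝ) 1) {x p : E} (hTx : ‖T x - p‖ ≤ ‖x - p‖) :
    ‖relaxedMap T t x - p‖ ≤ ‖x - p‖ := by
  rw [relaxedMap_sub]
  calc ‖(1 - t) • (x - p) + t • (T x - p)‖ ≤ ‖(1 - t) • (x - p)‖ + ‖t • (T x - p)‖ :=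
        norm_add_le _ _
    _ = (1 - t) * ‖x - p‖ + t * ‖T x - p‖ := by
        rw [norm_smul, norm_smul, Real.norm_of_nonneg (sub_nonneg.2 ht.2),
          Real.norm_of_nonneg ht.1]
    _ ≤ (1 - t) * ‖x - p‖ + t * ‖x - p‖ := by gcongr; exact ht.1
    _ = ‖x - p‖ := by ring

/-- The averaged map of a quasi-nonexpansive map is quasi-nonexpansive, `t ∈ [0,1]`.
[cite: Berinde2007, Ch. 3 §3.5, proof of Theorem 3.9, pp. 81–82] -/
theorem IsQuasiNonexpansiveOn.relaxedMap (h : IsQuasiNonexpansiveOn T D) (ht : t ∈ Icc (0 : ℝ) 1) :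
    IsQuasiNonexpansiveOn (relaxedMap T t) D := by
  intro p hp x hx
  rcases eq_or_ne t 0 with rfl | ht0
  · simp [relaxedMap_apply]
  rw [fixIn_relaxedMap ht0] at hp
  rw [dist_eq_norm, dist_eq_norm]
  refine norm_relaxedMap_sub_le ht ?_
  rw [← dist_eq_norm, ← dist_eq_norm]
  exact h hp hx

/-! ### Lemma 3.5 — uniformly convex spaces -/

/-- The uniform-convexity estimate: in a uniformly convex space, for `ε > 0` and `0 < t < 1`
there is `η < 1` with `‖(1 - t) a + t b‖ ≤ η r` whenever `‖a‖, ‖b‖ ≤ r`, `0 < r` and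
`‖a - b‖ ≥ ε r`.
[cite: Berinde2007, Ch. 3 §3.5, proof of Lemma 3.5, pp. 79–80 ("the uniform convexity of `X`
implies …")] -/
theorem exists_norm_combo_le [UniformConvexSpace E] {ε : ℝ} (hε : 0 < ε)
    (ht : t ∈ Ioo (0 : ℝ) 1) :
    ∃ η < 1, ∀ ⦃a b : E⦄ ⦃r : ℝ⦄, 0 < r → ‖a‖ ≤ r → ‖b‖ ≤ r → ε * r ≤ ‖a - b‖ →
      ‖(1 - t) • a + t • b‖ ≤ η * r := by
  obtain ⟨δ, hδ, hδ'⟩ := exists_forall_closed_ball_dist_add_le_two_sub E hε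
  have hμ : 0 < min t (1 - t) := lt_min ht.1 (sub_pos.2 ht.2)
  refine ⟨1 - min t (1 - t) * δ, sub_lt_self 1 (mul_pos hμ hδ), fun a b r hr ha hb hab => ?_⟩
  have hsum : ‖a + b‖ ≤ r * (2 - δ) := by
    have ha' : ‖r⁻¹ • a‖ ≤ 1 := by
      rw [norm_smul, Real.norm_of_nonneg (inv_nonneg.2 hr.le)]
      exact (inv_mul_le_iff₀ hr).2 (by rw [mul_one]; exact ha)
    have hb' : ‖r⁻¹ • b‖ ≤ 1 := by
      rw [norm_smul, Real.norm_of_nonneg (inv_nonneg.2 hr.le)]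
      exact (inv_mul_le_iff₀ hr).2 (by rw [mul_one]; exact hb)
    have hab' : ε ≤ ‖r⁻¹ • a - r⁻¹ • b‖ := by
      rw [← smul_sub, norm_smul, Real.norm_of_nonneg (inv_nonneg.2 hr.le)]
      exact (le_inv_mul_iff₀ hr).2 (by rw [mul_comm]; exact hab)
    have key := hδ' ha' hb' hab'
    rw [← smul_add, norm_smul, Real.norm_of_nonneg (inv_nonneg.2 hr.le)] at key
    exact (inv_mul_le_iff₀ hr).1 key
  rcases le_or_gt t (1 - t) with hle | hgt
  · have hid : (1 - t) • a + t • b = (1 - 2 * t) • a + t • (a + b) := by module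
    rw [hid]
    calc ‖(1 - 2 * t) • a + t • (a + b)‖ ≤ ‖(1 - 2 * t) • a‖ + ‖t • (a + b)‖ := norm_add_le _ _
      _ = (1 - 2 * t) * ‖a‖ + t * ‖a + b‖ := by
          rw [norm_smul, norm_smul, Real.norm_of_nonneg (by linarith), Real.norm_of_nonneg ht.1.le]
      _ ≤ (1 - 2 * t) * r + t * (r * (2 - δ)) := by
          gcongr
          · linarith
          · exact ht.1.le
      _ = (1 - t * δ) * r := by ring
      _ ≤ (1 - min t (1 - t) * δ) * r := by
          refine mul_le_mul_of_nonneg_right ?_ hr.le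
          have := mul_le_mul_of_nonneg_right (min_le_left t (1 - t)) hδ.le
          linarith
  · have hid : (1 - t) • a + t • b = (2 * t - 1) • b + (1 - t) • (a + b) := by module
    rw [hid]
    calc ‖(2 * t - 1) • b + (1 - t) • (a + b)‖
        ≤ ‖(2 * t - 1) • b‖ + ‖(1 - t) • (a + b)‖ := norm_add_le _ _
      _ = (2 * t - 1) * ‖b‖ + (1 - t) * ‖a + b‖ := by
          rw [norm_smul, norm_smul, Real.norm_of_nonneg (by linarith),
            Real.norm_of_nonneg (sub_nonneg.2 ht.2.le)]
      _ ≤ (2 * t - 1) * r + (1 - t) * (r * (2 - δ)) := by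
          gcongr
          · linarith
          · exact sub_nonneg.2 ht.2.le
      _ = (1 - (1 - t) * δ) * r := by ring
      _ ≤ (1 - min t (1 - t) * δ) * r := by
          refine mul_le_mul_of_nonneg_right ?_ hr.le
          have := mul_le_mul_of_nonneg_right (min_le_right t (1 - t)) hδ.le
          linarith

/-- **Lemma 3.5** (Petryshyn–Williamson, Lemma 2.1): `E` uniformly convex, `T p = p` and
`‖T y - p‖ ≤ ‖y - p‖` on `D` (quasi-nonexpansive with respect to `p`), `0 < t < 1`, and
`x (n+1) = T_t (x n)` an orbit of the averaged map staying in `D`.  Then `‖x n - T (x n)‖ → 0`.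
[cite: Berinde2007, Ch. 3 §3.5, Lemma 3.5, p. 79] -/
theorem tendsto_norm_sub_apply_of_uniformConvexSpace [UniformConvexSpace E] {p : E} {x : ℕ → E}
    (hT : ∀ y ∈ D, ‖T y - p‖ ≤ ‖y - p‖) (ht : t ∈ Ioo (0 : ℝ) 1)
    (hx : ∀ n, x (n + 1) = relaxedMap T t (x n)) (hxD : ∀ n, x n ∈ D) :
    Tendsto (fun n => ‖x n - T (x n)‖) atTop (𝓝 0) := by
  obtain ⟨r, hr⟩ : ∃ r : ℕ → ℝ, ∀ n, r n = ‖x n - p‖ := ⟨_, fun _ => rfl⟩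
  have ht' : t ∈ Icc (0 : ℝ) 1 := ⟨ht.1.le, ht.2.le⟩
  have hr_succ : ∀ n, r (n + 1) ≤ r n := fun n => by
    rw [hr, hr, hx n]
    exact norm_relaxedMap_sub_le ht' (hT _ (hxD n))
  have hanti : Antitone r := antitone_nat_of_succ_le hr_succ
  have hr0 : ∀ n, 0 ≤ r n := fun n => by rw [hr]; exact norm_nonneg _
  have hbdd : BddBelow (range r) := ⟨0, by rintro _ ⟨n, rfl⟩; exact hr0 n⟩
  have hrd : Tendsto r atTop (𝓝 (⨅ n, r n)) := tendsto_atTop_ciInf hanti hbdd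
  have hdle : ∀ n, (⨅ n, r n) ≤ r n := fun n => ciInf_le hbdd n
  have hd0 : 0 ≤ ⨅ n, r n := le_ciInf hr0
  have hbound : ∀ n, ‖x n - T (x n)‖ ≤ 2 * r n := fun n => by
    calc ‖x n - T (x n)‖ = ‖(x n - p) - (T (x n) - p)‖ := by rw [sub_sub_sub_cancel_right]
      _ ≤ ‖x n - p‖ + ‖T (x n) - p‖ := norm_sub_le _ _
      _ ≤ r n + r n := by rw [hr]; exact add_le_add le_rfl (hT _ (hxD n))
      _ = 2 * r n := by ring
  refine Metric.tendsto_atTop.2 fun ε hε => ?_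
  rcases hd0.eq_or_lt with hd | hdpos
  · -- the distances to `p` tend to `0`
    have h2 : Tendsto (fun n => 2 * r n) atTop (𝓝 0) := by
      have := hrd.const_mul 2
      rwa [← hd, mul_zero] at this
    obtain ⟨N, hN⟩ := Metric.tendsto_atTop.1 h2 ε hε
    refine ⟨N, fun n hn => ?_⟩
    have hN' := hN n hn
    rw [dist_zero_right, Real.norm_of_nonneg (by linarith [hr0 n])] at hN'
    rw [dist_zero_right, Real.norm_of_nonneg (norm_nonneg _)]
    exact (hbound n).trans_lt hN'
  · -- the distances to `p` stay above `d > 0`: uniform convexity forces `‖x n - T x n‖ → 0`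
    have hr0pos : 0 < r 0 := hdpos.trans_le (hdle 0)
    obtain ⟨η, hη1, hη⟩ := exists_norm_combo_le (E := E) (t := t) (div_pos hε hr0pos) ht
    have hlt : η * (⨅ n, r n) < ⨅ n, r n := by nlinarith
    have hev : ∀ᶠ n in atTop, η * r n < ⨅ n, r n :=
      (hrd.const_mul η).eventually (eventually_lt_nhds hlt)
    obtain ⟨N, hN⟩ := hev.exists_forall_of_atTop
    refine ⟨N, fun n hn => ?_⟩
    rw [dist_zero_right, Real.norm_of_nonneg (norm_nonneg _)]
    by_contra hge
    rw [not_lt] at hge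
    have hrn : 0 < r n := hdpos.trans_le (hdle n)
    have h3 : ε / r 0 * r n ≤ ‖(x n - p) - (T (x n) - p)‖ := by
      rw [sub_sub_sub_cancel_right]
      calc ε / r 0 * r n ≤ ε / r 0 * r 0 :=
            mul_le_mul_of_nonneg_left (hanti (Nat.zero_le n)) (div_pos hε hr0pos).le
        _ = ε := div_mul_cancel₀ ε hr0pos.ne'
        _ ≤ ‖x n - T (x n)‖ := hge
    have key : r (n + 1) ≤ η * r n := by
      have h1 : ‖x n - p‖ ≤ r n := (hr n).ge
      have h2 : ‖T (x n) - p‖ ≤ r n := (hT _ (hxD n)).trans (hr n).ge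
      have := hη hrn h1 h2 h3
      rw [hr, hx n, relaxedMap_sub]
      exact this
    linarith [hN n hn, hdle (n + 1)]

/-- **Lemma 3.5**, conclusion as printed: the averaged map `T_t` is asymptotically regular,
`x n - x (n+1) → 0` along its orbits.
[cite: Berinde2007, Ch. 3 §3.5, Lemma 3.5, p. 79] -/
theorem tendsto_sub_succ_of_uniformConvexSpace [UniformConvexSpace E] {p : E} {x : ℕ → E}
    (hT : ∀ y ∈ D, ‖T y - p‖ ≤ ‖y - p‖) (ht : t ∈ Ioo (0 : ℝ) 1)
    (hx : ∀ n, x (n + 1) = relaxedMap T t (x n)) (hxD : ∀ n, x n ∈ D) :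
    Tendsto (fun n => x n - x (n + 1)) atTop (𝓝 0) := by
  rw [tendsto_zero_iff_norm_tendsto_zero]
  have h := (tendsto_norm_sub_apply_of_uniformConvexSpace hT ht hx hxD).const_mul t
  rw [mul_zero] at h
  refine h.congr fun n => ?_
  rw [hx n, norm_sub_rev (x n) (relaxedMap T t (x n)), relaxedMap_sub_self, norm_smul,
    Real.norm_of_nonneg ht.1.le, norm_sub_rev (T (x n)) (x n)]

/-- **Lemma 3.5** for the Krasnoselskij iteration `relaxedIter T t x₀` of a quasi-nonexpansive
`T` with a fixed point in `D`: `‖x n - T (x n)‖ → 0`.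
[cite: Berinde2007, Ch. 3 §3.5, Lemma 3.5, p. 79] -/
theorem IsQuasiNonexpansiveOn.tendsto_norm_relaxedIter_sub_apply [UniformConvexSpace E]
    (h : IsQuasiNonexpansiveOn T D) (hne : (fixIn T D).Nonempty) (ht : t ∈ Ioo (0 : ℝ) 1)
    {x₀ : E} (hmem : ∀ n, relaxedIter T t x₀ n ∈ D) :
    Tendsto (fun n => ‖relaxedIter T t x₀ n - T (relaxedIter T t x₀ n)‖) atTop (𝓝 0) := by
  obtain ⟨p, hp⟩ := hne
  have hT : ∀ y ∈ D, ‖T y - p‖ ≤ ‖y - p‖ := fun y hy => by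
    rw [← dist_eq_norm, ← dist_eq_norm]
    exact h hp hy
  exact tendsto_norm_sub_apply_of_uniformConvexSpace hT ht (relaxedIter_succ T t x₀) hmem

/-- **Lemma 3.5** for the Krasnoselskij iteration, printed form: `x n - x (n+1) → 0`.
[cite: Berinde2007, Ch. 3 §3.5, Lemma 3.5, p. 79] -/
theorem IsQuasiNonexpansiveOn.tendsto_relaxedIter_sub_succ [UniformConvexSpace E]
    (h : IsQuasiNonexpansiveOn T D) (hne : (fixIn T D).Nonempty) (ht : t ∈ Ioo (0 : ℝ) 1)
    {x₀ : E} (hmem : ∀ n, relaxedIter T t x₀ n ∈ D) :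
    Tendsto (fun n => relaxedIter T t x₀ n - relaxedIter T t x₀ (n + 1)) atTop (𝓝 0) := by
  obtain ⟨p, hp⟩ := hne
  have hT : ∀ y ∈ D, ‖T y - p‖ ≤ ‖y - p‖ := fun y hy => by
    rw [← dist_eq_norm, ← dist_eq_norm]
    exact h hp hy
  exact tendsto_sub_succ_of_uniformConvexSpace hT ht (relaxedIter_succ T t x₀) hmem

/-- The orbit of the Krasnoselskij iteration stays in a convex `T`-invariant `D`.
[cite: Berinde2007, Ch. 3 §3.5, Lemma 3.5, p. 79 ("such that the Krasnoselskij iteration is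
defined and lies in `D`")] -/
theorem relaxedIter_mem_of_convex (hD : Convex ℝ D) (hTD : MapsTo T D D) (ht : t ∈ Icc (0 : ℝ) 1)
    {x₀ : E} (hx₀ : x₀ ∈ D) (n : ℕ) : relaxedIter T t x₀ n ∈ D :=
  relaxedIter_mem hD hTD ht hx₀ n

/-! ### Lemma 3.7 — the Frum–Ketkov condition passes to the averaged map -/

/-- **Lemma 3.7** (Petryshyn–Williamson, Lemma 3.1): if `K` is convex and
`infDist (T x) K ≤ k * infDist x K` for `x ∈ D` (condition (25)), then for `t ∈ [0,1]`,
`infDist (T_t x) K ≤ ((1 - t) + t * k) * infDist x K` for `x ∈ D`.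
[cite: Berinde2007, Ch. 3 §3.5, Lemma 3.7, pp. 80–81] -/
theorem infDist_relaxedMap_le {K : Set E} {k : ℝ} (hK : Convex ℝ K)
    (hFK : ∀ x ∈ D, infDist (T x) K ≤ k * infDist x K) (ht : t ∈ Icc (0 : ℝ) 1) {x : E}
    (hx : x ∈ D) : infDist (relaxedMap T t x) K ≤ ((1 - t) + t * k) * infDist x K := by
  rcases K.eq_empty_or_nonempty with hK0 | hKne
  · simp [hK0]
  refine le_of_forall_pos_le_add fun δ hδ => ?_
  obtain ⟨y, hy, hxy⟩ := (infDist_lt_iff hKne).1 (lt_add_of_pos_right (infDist x K) hδ)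
  obtain ⟨z, hz, hxz⟩ := (infDist_lt_iff hKne).1 (lt_add_of_pos_right (infDist (T x) K) hδ)
  have hw : (1 - t) • y + t • z ∈ K := hK hy hz (sub_nonneg.2 ht.2) ht.1 (sub_add_cancel 1 t)
  have hid : relaxedMap T t x - ((1 - t) • y + t • z) = (1 - t) • (x - y) + t • (T x - z) := by
    simp only [relaxedMap_apply]
    module
  calc infDist (relaxedMap T t x) K ≤ dist (relaxedMap T t x) ((1 - t) • y + t • z) :=
        infDist_le_dist_of_mem hw
    _ = ‖(1 - t) • (x - y) + t • (T x - z)‖ := by rw [dist_eq_norm, hid]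
    _ ≤ (1 - t) * ‖x - y‖ + t * ‖T x - z‖ := by
        refine (norm_add_le _ _).trans ?_
        rw [norm_smul, norm_smul, Real.norm_of_nonneg (sub_nonneg.2 ht.2),
          Real.norm_of_nonneg ht.1]
    _ ≤ (1 - t) * (infDist x K + δ) + t * (k * infDist x K + δ) := by
        rw [← dist_eq_norm, ← dist_eq_norm]
        have h1 : dist x y ≤ infDist x K + δ := hxy.le
        have h2 : dist (T x) z ≤ k * infDist x K + δ := hxz.le.trans (by linarith [hFK x hx])
        exact add_le_add (mul_le_mul_of_nonneg_left h1 (sub_nonneg.2 ht.2))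
          (mul_le_mul_of_nonneg_left h2 ht.1)
    _ = ((1 - t) + t * k) * infDist x K + δ := by ring

/-- Lemma 3.7 iterated: `infDist (x n) K ≤ q ^ n * infDist x₀ K` along the Krasnoselskij
iteration, with `q = max ((1 - t) + t k) 0 < 1` when `k < 1`, `0 < t`.
[cite: Berinde2007, Ch. 3 §3.5, proof of Theorem 3.9, pp. 81–82
("`d(x_n, K) ≤ k_λ^n d(x_0, K) → 0`")] -/
theorem infDist_relaxedIter_le {K : Set E} {k : ℝ} (hD : Convex ℝ D) (hTD : MapsTo T D D)
    (hK : Convex ℝ K) (hFK : ∀ x ∈ D, infDist (T x) K ≤ k * infDist x K)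
    (ht : t ∈ Icc (0 : ℝ) 1) {x₀ : E} (hx₀ : x₀ ∈ D) (n : ℕ) :
    infDist (relaxedIter T t x₀ n) K ≤ (max ((1 - t) + t * k) 0) ^ n * infDist x₀ K := by
  induction n with
  | zero => simp
  | succ n ih =>
    rw [relaxedIter_succ]
    calc infDist (relaxedMap T t (relaxedIter T t x₀ n)) K
        ≤ ((1 - t) + t * k) * infDist (relaxedIter T t x₀ n) K :=
          infDist_relaxedMap_le hK hFK ht (relaxedIter_mem hD hTD ht hx₀ n)
      _ ≤ max ((1 - t) + t * k) 0 * infDist (relaxedIter T t x₀ n) K :=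
          mul_le_mul_of_nonneg_right (le_max_left _ _) infDist_nonneg
      _ ≤ max ((1 - t) + t * k) 0 * ((max ((1 - t) + t * k) 0) ^ n * infDist x₀ K) :=
          mul_le_mul_of_nonneg_left ih (le_max_right _ _)
      _ = (max ((1 - t) + t * k) 0) ^ (n + 1) * infDist x₀ K := by ring

/-- Under condition (25) with `k < 1` and `0 < t ≤ 1`, `infDist (x n) K → 0` along the
Krasnoselskij iteration.
[cite: Berinde2007, Ch. 3 §3.5, proof of Theorem 3.9, pp. 81–82] -/
theorem tendsto_infDist_relaxedIter {K : Set E} {k : ℝ} (hD : Convex ℝ D) (hTD : MapsTo T D D)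
    (hK : Convex ℝ K) (hFK : ∀ x ∈ D, infDist (T x) K ≤ k * infDist x K) (hk : k < 1)
    (ht0 : 0 < t) (ht1 : t ≤ 1) {x₀ : E} (hx₀ : x₀ ∈ D) :
    Tendsto (fun n => infDist (relaxedIter T t x₀ n) K) atTop (𝓝 0) := by
  have hq0 : 0 ≤ max ((1 - t) + t * k) 0 := le_max_right _ _
  have hq1 : max ((1 - t) + t * k) 0 < 1 := max_lt (by nlinarith) one_pos
  have hlim : Tendsto (fun n => (max ((1 - t) + t * k) 0) ^ n * infDist x₀ K) atTop (𝓝 0) := by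
    simpa using (tendsto_pow_atTop_nhds_zero_of_lt_one hq0 hq1).mul_const (infDist x₀ K)
  exact squeeze_zero (fun _ => infDist_nonneg)
    (fun n => infDist_relaxedIter_le hD hTD hK hFK ⟨ht0.le, ht1⟩ hx₀ n) hlim

/-! ### Lemma 3.6 and Theorem 3.9 — strictly convex spaces -/

variable [StrictConvexSpace ℝ E]

/-- Strict quasi-nonexpansiveness of the averaged map in a strictly convex space: if
`‖T x - p‖ ≤ ‖x - p‖`, `T x ≠ x` and `0 < t < 1` then `‖T_t x - p‖ < ‖x - p‖`.
[cite: Berinde2007, Ch. 3 §3.5, proof of Theorem 3.9, pp. 81–82 ("`X` strictly convex, we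
deduce …")] -/
theorem norm_relaxedMap_sub_lt (ht : t ∈ Ioo (0 : ℝ) 1) {x p : E} (hTx : ‖T x - p‖ ≤ ‖x - p‖)
    (hne : T x ≠ x) : ‖relaxedMap T t x - p‖ < ‖x - p‖ := by
  rw [relaxedMap_sub]
  exact norm_combo_lt_of_ne le_rfl hTx (fun h => hne (sub_left_inj.1 h).symm) (sub_pos.2 ht.2)
    ht.1 (sub_add_cancel 1 t)

/-- **Lemma 3.6** (Petryshyn–Williamson, Lemma 2.2; Dotson): in a strictly convex space the
fixed point set in a convex `D` of a quasi-nonexpansive map is convex (continuity of `T` is not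
needed; closedness is `IsQuasiNonexpansiveOn.isClosed_fixIn`).
[cite: Berinde2007, Ch. 3 §3.5, Lemma 3.6, p. 80] -/
theorem IsQuasiNonexpansiveOn.convex_fixIn (h : IsQuasiNonexpansiveOn T D) (hD : Convex ℝ D) :
    Convex ℝ (fixIn T D) := by
  intro x hx y hy a b ha hb hab
  have hzD : a • x + b • y ∈ D := hD hx.1 hy.1 ha hb hab
  refine ⟨hzD, ?_⟩
  obtain ⟨z, hz⟩ : ∃ z : E, z = a • x + b • y := ⟨_, rfl⟩
  rw [← hz] at hzD ⊢
  have hxz : dist x z = b * dist x y := by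
    have hid : x - z = b • (x - y) := by
      rw [hz, show a = 1 - b by linarith]
      module
    rw [dist_eq_norm, dist_eq_norm, hid, norm_smul, Real.norm_of_nonneg hb]
  have hzy : dist z y = a * dist x y := by
    have hid : z - y = a • (x - y) := by
      rw [hz, show b = 1 - a by linarith]
      module
    rw [dist_eq_norm, dist_eq_norm, hid, norm_smul, Real.norm_of_nonneg ha]
  have h1 : dist x (T z) ≤ b * dist x y := by
    rw [dist_comm, ← hxz, dist_comm x z]
    exact h hx hzD
  have h2 : dist (T z) y ≤ a * dist x y := by
    rw [← hzy]
    exact h hy hzD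
  have htri : dist x y ≤ dist x (T z) + dist (T z) y := dist_triangle _ _ _
  have hsum : b * dist x y + a * dist x y = dist x y := by
    rw [← add_mul, add_comm, hab, one_mul]
  have e1 : dist x (T z) = b * dist x y := by linarith
  have e2 : dist (T z) y = (1 - b) * dist x y := by
    rw [show (1 : ℝ) - b = a by linarith]
    linarith
  have hTz := eq_lineMap_of_dist_eq_mul_of_dist_eq_mul e1 e2
  rw [AffineMap.lineMap_apply_module] at hTz
  rw [hTz, hz, show a = 1 - b by linarith]

/-- **Theorem 3.9** (Petryshyn–Williamson, Theorem 3.3), with continuity of `T` and the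
existence of a fixed point as explicit hypotheses (deviation (b)): `E` a strictly convex real
normed space, `D` closed convex, `T : D → D` continuous on `D` and quasi-nonexpansive with a
fixed point in `D`, `K` nonempty compact convex, `k < 1` with `infDist (T x) K ≤ k * infDist x K`
on `D` (condition (25)), `0 < t < 1`.  Then for every `x₀ ∈ D` the Krasnoselskij iteration
`x (n+1) = (1 - t) x n + t T (x n)` converges to a fixed point of `T` in `D`.
[cite: Berinde2007, Ch. 3 §3.5, Theorem 3.9, pp. 81–82] -/
theorem exists_mem_fixIn_tendsto_relaxedIter {K : Set E} {k : ℝ} {x₀ : E} (hDc : IsClosed D)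
    (hD : Convex ℝ D) (hTD : MapsTo T D D) (hcont : ContinuousOn T D)
    (h : IsQuasiNonexpansiveOn T D) (hfix : (fixIn T D).Nonempty) (hKc : IsCompact K)
    (hKne : K.Nonempty) (hK : Convex ℝ K) (hk : k < 1)
    (hFK : ∀ x ∈ D, infDist (T x) K ≤ k * infDist x K) (ht : t ∈ Ioo (0 : ℝ) 1)
    (hx₀ : x₀ ∈ D) : ∃ p ∈ fixIn T D, Tendsto (relaxedIter T t x₀) atTop (𝓝 p) := by
  have ht' : t ∈ Icc (0 : ℝ) 1 := ⟨ht.1.le, ht.2.le⟩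
  obtain ⟨x, hx⟩ : ∃ x : ℕ → E, ∀ n, x n = relaxedIter T t x₀ n := ⟨_, fun _ => rfl⟩
  have hxs : ∀ n, x (n + 1) = relaxedMap T t (x n) := fun n => by
    rw [hx, hx, relaxedIter_succ]
  have hxD : ∀ n, x n ∈ D := fun n => by
    rw [hx]
    exact relaxedIter_mem hD hTD ht' hx₀ n
  -- Step 1: the distance of the orbit to `K` tends to zero (Lemma 3.7).
  have hK0 : Tendsto (fun n => infDist (x n) K) atTop (𝓝 0) := by
    refine (tendsto_infDist_relaxedIter hD hTD hK hFK hk ht.1 ht.2.le hx₀).congr fun n => ?_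
    rw [hx]
  -- Step 2: nearest points in the compact `K` and a convergent subsequence of the orbit.
  choose y hyK hy using fun n => hKc.exists_infDist_eq_dist hKne (x n)
  obtain ⟨a, -, φ, hφ, hya⟩ := hKc.tendsto_subseq hyK
  have hxa : Tendsto (x ∘ φ) atTop (𝓝 a) := by
    rw [tendsto_iff_dist_tendsto_zero]
    have h1 : Tendsto (fun j => dist (x (φ j)) (y (φ j))) atTop (𝓝 0) := by
      refine (hK0.comp hφ.tendsto_atTop).congr fun j => ?_
      simp only [Function.comp_apply, hy]
    have h2 : Tendsto (fun j => dist (y (φ j)) a) atTop (𝓝 0) :=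
      tendsto_iff_dist_tendsto_zero.1 hya
    refine squeeze_zero (fun _ => dist_nonneg) (fun j => dist_triangle (x (φ j)) (y (φ j)) a) ?_
    simpa using h1.add h2
  -- Step 3: `T_t` is continuous, quasi-nonexpansive and — by strict convexity — strictly
  -- quasi-nonexpansive at non-fixed points; apply the subsequence criterion to its orbit.
  have hU : IsQuasiNonexpansiveOn (relaxedMap T t) D := h.relaxedMap ht'
  have hcontU : ContinuousOn (relaxedMap T t) D := by
    have hUdef : relaxedMap T t = fun z => (1 - t) • z + t • T z :=
      funext fun z => relaxedMap_apply T t z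
    rw [hUdef]
    exact (continuousOn_id.const_smul (1 - t)).add (hcont.const_smul t)
  have hstrict : ∀ z ∈ D, relaxedMap T t z ≠ z →
      ∃ p ∈ fixIn (relaxedMap T t) D, dist (relaxedMap T t z) p < dist z p := by
    intro z hz hne
    obtain ⟨p, hp⟩ := hfix
    refine ⟨p, by rwa [fixIn_relaxedMap ht.1.ne'], ?_⟩
    have hTz : ‖T z - p‖ ≤ ‖z - p‖ := by
      rw [← dist_eq_norm, ← dist_eq_norm]
      exact h hp hz
    rw [dist_eq_norm, dist_eq_norm]
    exact norm_relaxedMap_sub_lt ht hTz fun hfz => hne ((relaxedMap_eq_self_iff ht.1.ne').2 hfz)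
  obtain ⟨haF, hlim⟩ := hU.tendsto_of_subseq_tendsto hDc hcontU hstrict hxs hxD hφ hxa
  rw [fixIn_relaxedMap ht.1.ne'] at haF
  refine ⟨a, haF, ?_⟩
  have hfun : relaxedIter T t x₀ = x := funext fun n => (hx n).symm
  rwa [hfun]

end Normed

/-! ### The printed Theorem 3.9 needs continuity: a counterexample on `ℝ` -/

namespace Counterexample

/-- The map of the counterexample: `T x = x / 2` for `x < 1`, `T 1 = 0`, `T x = (1 + x) / 2`
for `x > 1`.  It is quasi-nonexpansive on `ℝ` with `Fix T = {0}`, satisfies the Frum–Ketkov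
condition (25) with `K = [-2, 2]`, `k = 1/2`, but is discontinuous at `1`, and its Krasnoselskij
iterates from `x₀ = 2` converge to the non-fixed point `1`.
[cite: Berinde2007, Ch. 3 §3.5, Theorem 3.9, pp. 81–82 (shows the continuity hypothesis of
deviation (b) cannot be dropped)] -/
noncomputable def cexMap (x : ℝ) : ℝ :=
  if x < 1 then x / 2 else if x = 1 then 0 else (1 + x) / 2

/-- [cite: Berinde2007, Ch. 3 §3.5, Theorem 3.9 (counterexample to the printed form)] -/
theorem cexMap_of_lt_one {x : ℝ} (hx : x < 1) : cexMap x = x / 2 := by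
  simp [cexMap, hx]

/-- [cite: Berinde2007, Ch. 3 §3.5, Theorem 3.9 (counterexample to the printed form)] -/
theorem cexMap_one : cexMap 1 = 0 := by
  simp [cexMap]

/-- [cite: Berinde2007, Ch. 3 §3.5, Theorem 3.9 (counterexample to the printed form)] -/
theorem cexMap_of_one_lt {x : ℝ} (hx : 1 < x) : cexMap x = (1 + x) / 2 := by
  simp [cexMap, not_lt.2 hx.le, hx.ne']

/-- `Fix T = {0}`.
[cite: Berinde2007, Ch. 3 §3.5, Theorem 3.9 (counterexample to the printed form)] -/
theorem fixIn_cexMap : fixIn cexMap univ = {0} := by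
  ext x
  simp only [mem_fixIn, mem_univ, true_and, mem_singleton_iff]
  constructor
  · intro hx
    rcases lt_trichotomy x 1 with h | rfl | h
    · rw [cexMap_of_lt_one h] at hx
      linarith
    · rw [cexMap_one] at hx
      norm_num at hx
    · rw [cexMap_of_one_lt h] at hx
      linarith
  · rintro rfl
    rw [cexMap_of_lt_one (by norm_num)]
    norm_num

/-- `|T x| ≤ |x|` for every `x`.
[cite: Berinde2007, Ch. 3 §3.5, Theorem 3.9 (counterexample to the printed form)] -/
theorem abs_cexMap_le (x : ℝ) : |cexMap x| ≤ |x| := by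
  rcases lt_trichotomy x 1 with h | rfl | h
  · rw [cexMap_of_lt_one h, abs_div, abs_two]
    linarith [abs_nonneg x]
  · rw [cexMap_one]
    norm_num
  · rw [cexMap_of_one_lt h, abs_of_pos (by linarith), abs_of_pos (by linarith)]
    linarith

/-- `T` is quasi-nonexpansive on `ℝ` (and has the fixed point `0`).
[cite: Berinde2007, Ch. 3 §3.5, Theorem 3.9 (counterexample to the printed form)] -/
theorem isQuasiNonexpansiveOn_cexMap : IsQuasiNonexpansiveOn cexMap univ := by
  intro p hp x _
  rw [fixIn_cexMap, mem_singleton_iff] at hp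
  subst hp
  rw [Real.dist_eq, Real.dist_eq, sub_zero, sub_zero]
  exact abs_cexMap_le x

/-- `T` is not continuous at `1`.
[cite: Berinde2007, Ch. 3 §3.5, Theorem 3.9 (counterexample to the printed form)] -/
theorem not_continuousAt_cexMap : ¬ ContinuousAt cexMap 1 := by
  intro hc
  have h1 : Tendsto cexMap (𝓝[>] (1 : ℝ)) (𝓝 (cexMap 1)) :=
    hc.tendsto.mono_left nhdsWithin_le_nhds
  have h2 : Tendsto (fun x : ℝ => (1 + x) / 2) (𝓝[>] (1 : ℝ)) (𝓝 1) := by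
    have h : Tendsto (fun x : ℝ => (1 + x) / 2) (𝓝 (1 : ℝ)) (𝓝 (((1 : ℝ) + 1) / 2)) :=
      ((continuous_const.add continuous_id).div_const 2).tendsto 1
    rw [show ((1 : ℝ) + 1) / 2 = 1 by norm_num] at h
    exact h.mono_left nhdsWithin_le_nhds
  have h3 : Tendsto cexMap (𝓝[>] (1 : ℝ)) (𝓝 1) :=
    h2.congr' (eventually_nhdsWithin_of_forall fun x hx => (cexMap_of_one_lt hx).symm)
  have h01 := tendsto_nhds_unique h1 h3
  rw [cexMap_one] at h01
  norm_num at h01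

/-- The lower bound `|x| - 2 ≤ infDist x [-2, 2]`.
[cite: Berinde2007, Ch. 3 §3.5, Theorem 3.9 (counterexample to the printed form)] -/
theorem abs_sub_two_le_infDist (x : ℝ) : |x| - 2 ≤ infDist x (Icc (-2 : ℝ) 2) := by
  refine (le_infDist ⟨0, by norm_num⟩).2 fun y hy => ?_
  rw [Real.dist_eq]
  have h1 : |x| - |y| ≤ |x - y| := abs_sub_abs_le_abs_sub x y
  have h2 : |y| ≤ 2 := abs_le.2 ⟨hy.1, hy.2⟩
  linarith

/-- The Frum–Ketkov condition (25) for `T`, with `K = [-2, 2]` and `k = 1/2`.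
[cite: Berinde2007, Ch. 3 §3.5, Theorem 3.9 condition (25) (counterexample to the printed
form)] -/
theorem infDist_cexMap_le (x : ℝ) :
    infDist (cexMap x) (Icc (-2 : ℝ) 2) ≤ 1 / 2 * infDist x (Icc (-2 : ℝ) 2) := by
  have hrhs : 0 ≤ 1 / 2 * infDist x (Icc (-2 : ℝ) 2) := mul_nonneg (by norm_num) infDist_nonneg
  by_cases hTK : cexMap x ∈ Icc (-2 : ℝ) 2
  · rw [infDist_zero_of_mem hTK]
    exact hrhs
  rw [mem_Icc, not_and_or, not_le, not_le] at hTK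
  have hlow := abs_sub_two_le_infDist x
  rcases hTK with hlt | hgt
  · -- `T x < -2`, hence `x < 1` and `T x = x / 2`, `x < -4`
    have hx1 : x < 1 := by
      by_contra hx1
      rcases (not_lt.1 hx1).eq_or_lt with rfl | h
      · rw [cexMap_one] at hlt; norm_num at hlt
      · rw [cexMap_of_one_lt h] at hlt; linarith
    rw [cexMap_of_lt_one hx1] at hlt ⊢
    have hx4 : x < -4 := by linarith
    calc infDist (x / 2) (Icc (-2 : ℝ) 2) ≤ dist (x / 2) (-2) :=
          infDist_le_dist_of_mem (by norm_num)
      _ = -2 - x / 2 := by rw [Real.dist_eq, abs_of_neg (by linarith)]; ring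
      _ ≤ 1 / 2 * (|x| - 2) := by rw [abs_of_neg (by linarith)]; linarith
      _ ≤ 1 / 2 * infDist x (Icc (-2 : ℝ) 2) := by linarith
  · -- `T x > 2`, hence `x > 1` and `T x = (1 + x) / 2`, `x > 3`
    have hx1 : 1 < x := by
      by_contra hx1
      rcases (not_lt.1 hx1).eq_or_lt with h | h
      · rw [h, cexMap_one] at hgt; norm_num at hgt
      · rw [cexMap_of_lt_one h] at hgt; linarith
    rw [cexMap_of_one_lt hx1] at hgt ⊢
    have hx3 : 3 < x := by linarith
    calc infDist ((1 + x) / 2) (Icc (-2 : ℝ) 2) ≤ dist ((1 + x) / 2) 2 :=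
          infDist_le_dist_of_mem (by norm_num)
      _ = (x - 3) / 2 := by rw [Real.dist_eq, abs_of_pos (by linarith)]; ring
      _ ≤ 1 / 2 * (|x| - 2) := by rw [abs_of_pos (by linarith)]; linarith
      _ ≤ 1 / 2 * infDist x (Icc (-2 : ℝ) 2) := by linarith

/-- The Krasnoselskij iterates from `x₀ = 2`: `x n = 1 + (1 - t/2) ^ n`.
[cite: Berinde2007, Ch. 3 §3.5, Theorem 3.9 (counterexample to the printed form)] -/
theorem relaxedIter_cexMap_two {t : ℝ} (ht : t ∈ Ioo (0 : ℝ) 1) (n : ℕ) :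
    relaxedIter cexMap t 2 n = 1 + (1 - t / 2) ^ n := by
  induction n with
  | zero => simp [relaxedIter_zero]; norm_num
  | succ n ih =>
    have hc : (0 : ℝ) < (1 - t / 2) ^ n := pow_pos (by linarith [ht.2]) n
    rw [relaxedIter_succ, ih, relaxedMap_apply, cexMap_of_one_lt (by linarith), smul_eq_mul,
      smul_eq_mul]
    ring

/-- The iterates converge to `1`.
[cite: Berinde2007, Ch. 3 §3.5, Theorem 3.9 (counterexample to the printed form)] -/
theorem tendsto_relaxedIter_cexMap_two {t : ℝ} (ht : t ∈ Ioo (0 : ℝ) 1) :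
    Tendsto (relaxedIter cexMap t 2) atTop (𝓝 1) := by
  have hfun : relaxedIter cexMap t 2 = fun n => 1 + (1 - t / 2) ^ n :=
    funext (relaxedIter_cexMap_two ht)
  rw [hfun]
  simpa using (tendsto_pow_atTop_nhds_zero_of_lt_one (by linarith [ht.2])
    (by linarith [ht.1] : 1 - t / 2 < 1)).const_add (1 : ℝ)

/-- **The printed Theorem 3.9 is false without continuity**: for `T = cexMap`, `D = ℝ` (closed,
convex, `T`-invariant), `T` quasi-nonexpansive with `Fix T = {0} ≠ ∅`, `K = [-2, 2]` compact
convex, `k = 1/2 < 1`, condition (25) (`infDist_cexMap_le`) and any `0 < t < 1`, the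
Krasnoselskij iteration from `x₀ = 2` does not converge to a fixed point of `T` (it converges
to `1`, and `T 1 = 0`).
[cite: Berinde2007, Ch. 3 §3.5, Theorem 3.9, pp. 81–82 (counterexample to the printed form;
justifies deviation (b))] -/
theorem not_exists_tendsto_relaxedIter {t : ℝ} (ht : t ∈ Ioo (0 : ℝ) 1) :
    ¬ ∃ p ∈ fixIn cexMap univ, Tendsto (relaxedIter cexMap t 2) atTop (𝓝 p) := by
  rintro ⟨p, hp, hlim⟩
  rw [fixIn_cexMap, mem_singleton_iff] at hp
  subst hp
  have h01 : (1 : ℝ) = 0 := tendsto_nhds_unique (tendsto_relaxedIter_cexMap_two ht) hlim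
  norm_num at h01

/-- Summary: every hypothesis of `exists_mem_fixIn_tendsto_relaxedIter` other than
`ContinuousOn T D` is met by the counterexample, yet its conclusion fails.
[cite: Berinde2007, Ch. 3 §3.5, Theorem 3.9, pp. 81–82 (counterexample to the printed form)] -/
theorem hypotheses_of_printed_theorem_39 {t : ℝ} (ht : t ∈ Ioo (0 : ℝ) 1) :
    IsClosed (univ : Set ℝ) ∧ Convex ℝ (univ : Set ℝ) ∧ MapsTo cexMap univ univ ∧
      IsQuasiNonexpansiveOn cexMap univ ∧ (fixIn cexMap univ).Nonempty ∧
      IsCompact (Icc (-2 : ℝ) 2) ∧ (Icc (-2 : ℝ) 2).Nonempty ∧ Convex ℝ (Icc (-2 : ℝ) 2) ∧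
      (1 / 2 : ℝ) < 1 ∧
      (∀ x ∈ (univ : Set ℝ), infDist (cexMap x) (Icc (-2 : ℝ) 2) ≤
        1 / 2 * infDist x (Icc (-2 : ℝ) 2)) ∧
      t ∈ Ioo (0 : ℝ) 1 ∧ (2 : ℝ) ∈ (univ : Set ℝ) ∧ ¬ ContinuousOn cexMap univ ∧
      ¬ ∃ p ∈ fixIn cexMap univ, Tendsto (relaxedIter cexMap t 2) atTop (𝓝 p) := by
  refine ⟨isClosed_univ, convex_univ, mapsTo_univ _ _, isQuasiNonexpansiveOn_cexMap,
    ⟨0, by rw [fixIn_cexMap]; rfl⟩, isCompact_Icc, ⟨0, by norm_num⟩, convex_Icc _ _,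
    by norm_num, fun x _ => infDist_cexMap_le x, ht, mem_univ _, ?_,
    not_exists_tendsto_relaxedIter ht⟩
  intro hc
  exact not_continuousAt_cexMap (hc.continuousAt (Filter.univ_mem))

end Counterexample

end Literature.Analysis.Convex.QuasiNonexpansiveOperators
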